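import Summits.QuantumFields.YangMills.Theorems.LangevinControlUVOSLegsAtWeakCouplingCStubDensity
import Summits.QuantumFields.YangMills.Theorems.PencilRigidityCurvatureKernelBoundCruxToLocalDecay
import HarnessLib

/-!
# Crux `OSLegsAtWeakCouplingC` (stmt-QuantumFields-16207), line `Sketch`: the two-point local decay of a soft-bundle limit

Support file (continuation lead c4).  The landed bridge `osLegsAtWeakCouplingC_of_outputs_pencil` (…SketchPencil, p136895)
takes route `PencilRigidity`'s item `CurvatureKernelBound` (stmt-QuantumFields-11687) as a hypothesis.  Along a soft bundle
that item is NOT needed: its conclusion for the bundle's limit `S₁` follows from the E0′ import `MomentBounds6` by the landed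
per-witness theorem `CurvatureKernel.KernelConclusionOfWitnessLocalDecay` (line `sixteen-charts-analytic-kernel` of that crux:
`W₁` + the TWO-POINT LOCAL DECAY of `S₁` ⇒ a real kernel continuous off `0`, below `|x|^(η−10)`, representing `S₁ 2` on
`⁰𝒮`), once the local decay is established.  This file establishes it:

* `offDiagDensity_quant` — the landed `stub_density` with its constant exposed: along a soft bundle in units carrying
  `MomentBounds6` (constants `C, ℓ₄`), for every arity `n ≥ 2`, every `δ > 0` and every compactly supported `F` with
  `tsupport F ⊆ Separated n δ`, `‖S₁ n F‖ ≤ (C (24/δ + 2/ℓ₄ + 24)⁴)ⁿ ∫ ‖F‖` (proof verbatim: collar radius, no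
  wrap-around, Riemann sums);
* `twoPointLocalDecay_of_bundle` — hence the two-point local decay of `S₁` in the exact currency of
  `KernelConclusionOfWitnessLocalDecay`, with `η = 2` (the scaling dimension `4` of `tr F²`: `|x|⁻⁸ = |x|^(2−10)`),
  `s₁ = 1`, `r₀ = s/2`, `A = (C (24/s + 2/ℓ₄ + 24)⁴)²`, `B = 0`, `C_T = (C (48 + 2/ℓ₄)⁴)²`: a real tensor `f 0 ⊗ f 1`
  supported in the `r`-balls about `∓ s e₀` (`r ≤ s/2`) is compactly supported in `Separated 2 s`, and
  `∫ |f 0 ⊗ f 1| = ‖f 0‖₁ ‖f 1‖₁`.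

Refs: GlimmJaffe1987 §6.1; OsterwalderSchrader1973 §2, §4.
-/

set_option autoImplicit false

noncomputable section

open scoped SchwartzMap BigOperators
open MeasureTheory Filter Topology Metric
open Literature.MathematicalPhysics.QuantumFieldTheory Literature.MathematicalPhysics.QuantumLattice
open Literature.MathematicalPhysics.AQFT
open Literature.Probability.LatticeModels (box Site mem_box)
open Summit.QuantumFields.YangMills.Cruxes.OSLegsFromFemtoAndGap.DlrCollarTransfer
  (MomentBounds MomentBounds6 SoftBundle)
open Summit.QuantumFields.YangMills.Theorems.OSLegsFromFemtoAndGap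
open Summit.QuantumFields.YangMills.Theorems.CurvatureKernel.CruxToLocalDecayAux (integral_abs_tensor)
open Summit.QuantumFields.YangMills.Theorems.CurvatureKernel.TwoPointLocal (norm_sub_mem_window_of_balls)

namespace Summit.QuantumFields.YangMills.Cruxes.OSLegsAtWeakCouplingC.Sketch

/-- **Quantitative bounded densities of a soft-bundle limit off the diagonal** (the landed `stub_density` with its
constant exposed): along a soft bundle in units carrying `MomentBounds6` with constants `C, ℓ₄`, for `n ≥ 2`, `δ > 0` and
compactly supported `F` with `tsupport F ⊆ Separated n δ`, `‖S₁ n F‖ ≤ (C (24/δ + 2/ℓ₄ + 24)⁴)ⁿ ∫ ‖F‖`. -/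
theorem offDiagDensity_quant {G : Type} [Group G] [TopologicalSpace G] [IsTopologicalGroup G] [CompactSpace G]
    [MeasurableSpace G] [BorelSpace G] (r : LatticeRep G) (a : ℝ → ℝ) (sch : SpeciesScheme (YMSpecies G))
    (S₁ : SchwingerFamily (EuclideanSpace ℝ (Fin 4)))
    (Tq : (n : ℕ) → (Fin n → Fin 4 × Fin 4) → (𝓢((Fin n → EuclideanSpace ℝ (Fin 4)), ℂ) →L[ℂ] ℂ)) (K : ℝ) (b₀ : ℝ)
    (g : ℝ → ℕ → ℕ) (hMB6 : MomentBounds6 G r a) (hSB : SoftBundle G r a sch S₁ Tq K b₀ g) :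
    ∃ C ℓ₄ : ℝ, 0 ≤ C ∧ 0 < ℓ₄ ∧ ∀ (N : ℕ), 2 ≤ N → ∀ (δ : ℝ), 0 < δ →
      ∀ F : 𝓢((Fin N → EuclideanSpace ℝ (Fin 4)), ℂ), HasCompactSupport (F : (Fin N → EuclideanSpace ℝ (Fin 4)) → ℂ) →
        tsupport (F : (Fin N → EuclideanSpace ℝ (Fin 4)) → ℂ) ⊆ Separated N δ →
        ‖S₁ N F‖ ≤ (C * (24 / δ + 2 / ℓ₄ + 24) ^ 4) ^ N * ∫ y, ‖F y‖ := by
  -- adapted from the landed `stub_density` (arity `N ≥ 2` branch), constants exposed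
  classical
  obtain ⟨⟨hunits, -, -, hβ, -, -, -, -, -, -, hconv, -, -, -, -, -, hranges, -, -, -, -⟩, -⟩ := hSB
  obtain ⟨C, β₄, ℓ₄, hℓ, hC, H⟩ :=
    abs_torusMoment_le_of_momentBounds r (momentBounds_of_momentBounds6 r a hMB6)
  refine ⟨C, ℓ₄, hC, hℓ, fun N hN2 δ hδ F hFc hFs => ?_⟩
  set κ : ℝ := 24 / δ + 2 / ℓ₄ + 24 with hκ
  have hκ0 : 0 < κ := by positivity
  -- `F` is off-diagonal: its support avoids the coincidence locus
  have hFoff : IsOffDiagonal F := by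
    refine IsOffDiagonal.of_tsupport_subset fun y hy hcoin => ?_
    obtain ⟨i, j, hij, hyij⟩ := (mem_coincidenceLocus y).1 hcoin
    have h : δ ≤ dist (y i) (y j) := hFs hy i j hij
    rw [hyij, dist_self] at h
    exact absurd h (not_le.2 hδ)
  -- a support radius
  obtain ⟨ρ, hρ0, hρ⟩ : ∃ ρ : ℝ, 0 ≤ ρ ∧ tsupport (F : (Fin N → EuclideanSpace ℝ (Fin 4)) → ℂ) ⊆
      closedBall (0 : Fin N → EuclideanSpace ℝ (Fin 4)) ρ := by
    obtain ⟨ρ, hρ⟩ := hFc.isCompact.isBounded.subset_closedBall 0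
    exact ⟨max ρ 0, le_max_right _ _, hρ.trans (closedBall_subset_closedBall (le_max_left _ _))⟩
  -- the two limits: lattice distributions → `S₁ N F`, Riemann sums → `∫ ‖F‖`
  have hlim : Tendsto (fun k => ‖latticeDist r.ρ (sch.β k) (sch.L k) (sch.a k) r.curvature.F
      (wilsonTorusMean r.ρ (sch.β k) (sch.L k) r.curvature.F) N F‖) atTop (𝓝 ‖S₁ N F‖) :=
    (hconv N hN2 F hFoff).norm
  have hRiem : Tendsto (fun k => sch.a k ^ (4 * N) *
      ∑ x ∈ Fintype.piFinset (fun _ : Fin N => box 4 (sch.L k)), ‖F (fun i => sch.a k • siteToE (x i))‖)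
      atTop (𝓝 (∫ y, ‖F y‖)) :=
    tendsto_riemann_sum (fun y => ‖F y‖) F.continuous.norm hFc.norm sch.a sch.L sch.a_pos sch.tendsto_a
      sch.tendsto_L
  -- eventual domination of the lattice distributions by the Riemann sums
  have hev : ∀ᶠ k in atTop, ‖latticeDist r.ρ (sch.β k) (sch.L k) (sch.a k) r.curvature.F
      (wilsonTorusMean r.ρ (sch.β k) (sch.L k) r.curvature.F) N F‖ ≤
      (C * κ ^ 4) ^ N * (sch.a k ^ (4 * N) *
        ∑ x ∈ Fintype.piFinset (fun _ : Fin N => box 4 (sch.L k)), ‖F (fun i => sch.a k • siteToE (x i))‖) := by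
    have hε : 0 < min (min 1 ℓ₄) (δ / 12) := lt_min (lt_min one_pos hℓ) (by positivity)
    filter_upwards [hβ.eventually_ge_atTop β₄, sch.tendsto_a.eventually (gt_mem_nhds hε),
      sch.tendsto_L.eventually_ge_atTop (2 * ρ)] with k hkβ hka hkL
    have hapos : 0 < sch.a k := sch.a_pos k
    have ha1 : sch.a k ≤ 1 := (hka.le.trans (min_le_left _ _)).trans (min_le_left _ _)
    have haℓ : sch.a k ≤ ℓ₄ := (hka.le.trans (min_le_left _ _)).trans (min_le_right _ _)
    have haδ : sch.a k * 12 ≤ δ := by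
      have := hka.le.trans (min_le_right _ _)
      rwa [le_div_iff₀ (by norm_num : (0 : ℝ) < 12)] at this
    obtain ⟨-, -, hL14, hLa⟩ := hranges k
    -- collar radius for the lattice separation `δ / (2 a_k) ≥ 6`
    have hδ6 : 6 ≤ δ / (2 * sch.a k) := by
      rw [le_div_iff₀ (by positivity)]
      linarith
    obtain ⟨R, hR1, hRa, hRL, hRδ, hRinv⟩ := exists_collar_radius hδ6 hℓ hapos ha1 haℓ hL14 hLa
    have hRpos : (0 : ℝ) < R := by exact_mod_cast hR1
    have hRinv' : (R : ℝ)⁻¹ ≤ sch.a k * κ := by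
      have : 12 / (δ / (2 * sch.a k)) + sch.a k * (2 / ℓ₄ + 24) = sch.a k * κ := by
        rw [hκ, div_div_eq_mul_div]
        ring
      rw [← this]
      exact hRinv
    -- the collar bound at the lattice multi-sites seen by `F`
    have hW : ∀ x : Fin N → Site 4, F (fun i => sch.a k • siteToE (x i)) ≠ 0 →
        |torusMoment r.ρ (sch.β k) (sch.L k) r.curvature.F
            (wilsonTorusMean r.ρ (sch.β k) (sch.L k) r.curvature.F) x| ≤
          (C * κ ^ 4) ^ N * sch.a k ^ (4 * N) := by
      intro x hx
      have hy : (fun i => sch.a k • siteToE (x i)) ∈ tsupport (F : (Fin N → EuclideanSpace ℝ (Fin 4)) → ℂ) :=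
        subset_tsupport _ (Function.mem_support.2 hx)
      -- no wrap-around: all sites in the bulk of the torus
      have hwrap : ∀ i, 2 * ‖x i‖ ≤ (sch.L k : ℝ) := by
        intro i
        have h1 := hρ hy
        rw [mem_closedBall, dist_zero_right] at h1
        have h2 : sch.a k * ‖x i‖ ≤ ρ :=
          (mul_norm_le_norm_smul_siteToE hapos.le (x i)).trans ((norm_le_pi_norm _ i).trans h1)
        have h3 : sch.a k * (2 * ‖x i‖) ≤ sch.a k * (sch.L k : ℝ) := by linarith
        exact le_of_mul_le_mul_left h3 hapos
      -- lattice sup-separation `≥ δ / (2 a_k) ≥ 2R + 4`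
      have hsepx : ∀ i j : Fin N, i ≠ j → 2 * (R : ℝ) + 4 ≤ ‖x i - x j‖ := by
        intro i j hij
        have h1 : δ ≤ dist (sch.a k • siteToE (x i)) (sch.a k • siteToE (x j)) := hFs hy i j hij
        rw [dist_eq_norm] at h1
        have h2 := norm_smul_siteToE_sub_le hapos.le (x i) (x j)
        have h3 : δ / (2 * sch.a k) ≤ ‖x i - x j‖ := by
          rw [div_le_iff₀ (by positivity)]
          linarith
        exact hRδ.trans h3
      have hsep : ∀ i j : Fin N, i ≠ j → ∃ l : Fin 4,
          (2 * (R : ℤ) + 4) ≤ |((((x i l - x j l : ℤ) : ZMod (2 * sch.L k + 1))).valMinAbs : ℤ)| := by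
        intro i j hij
        obtain ⟨l, hl⟩ := exists_valMinAbs_ge_of_norm_le x hwrap i j (hsepx i j hij)
        exact ⟨l, by exact_mod_cast hl⟩
      have hRa' : (R : ℝ) * a (sch.β k) ≤ ℓ₄ := by
        rw [← hunits k]
        exact hRa
      have h1 := H (sch.β k) hkβ (sch.L k) N x R hR1 hRa' hRL hsep
      have h2 : C / (R : ℝ) ^ 4 ≤ C * κ ^ 4 * sch.a k ^ 4 := by
        have h3 : ((R : ℝ)⁻¹) ^ 4 ≤ (sch.a k * κ) ^ 4 :=
          pow_le_pow_left₀ (inv_nonneg.2 hRpos.le) hRinv' 4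
        calc C / (R : ℝ) ^ 4 = C * ((R : ℝ)⁻¹) ^ 4 := by rw [div_eq_mul_inv, inv_pow]
          _ ≤ C * (sch.a k * κ) ^ 4 := mul_le_mul_of_nonneg_left h3 hC
          _ = C * κ ^ 4 * sch.a k ^ 4 := by ring
      calc _ ≤ (C / (R : ℝ) ^ 4) ^ N := h1
        _ ≤ (C * κ ^ 4 * sch.a k ^ 4) ^ N :=
            pow_le_pow_left₀ (div_nonneg hC (pow_nonneg hRpos.le 4)) h2 N
        _ = (C * κ ^ 4) ^ N * sch.a k ^ (4 * N) := by rw [mul_pow, pow_mul]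
    -- sum over the torus
    rw [latticeDist_apply]
    refine (norm_sum_le _ _).trans ?_
    calc ∑ x ∈ Fintype.piFinset (fun _ : Fin N => box 4 (sch.L k)),
          ‖((torusMoment r.ρ (sch.β k) (sch.L k) r.curvature.F
              (wilsonTorusMean r.ρ (sch.β k) (sch.L k) r.curvature.F) x : ℝ) : ℂ) *
            F (fun i => sch.a k • siteToE (x i))‖
        ≤ ∑ x ∈ Fintype.piFinset (fun _ : Fin N => box 4 (sch.L k)),
          (C * κ ^ 4) ^ N * sch.a k ^ (4 * N) * ‖F (fun i => sch.a k • siteToE (x i))‖ := by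
          refine Finset.sum_le_sum fun x _ => ?_
          rw [norm_mul, Complex.norm_real, Real.norm_eq_abs]
          by_cases hx : F (fun i => sch.a k • siteToE (x i)) = 0
          · simp [hx]
          · exact mul_le_mul_of_nonneg_right (hW x hx) (norm_nonneg _)
      _ = (C * κ ^ 4) ^ N * (sch.a k ^ (4 * N) *
          ∑ x ∈ Fintype.piFinset (fun _ : Fin N => box 4 (sch.L k)), ‖F (fun i => sch.a k • siteToE (x i))‖) := by
          rw [Finset.mul_sum, Finset.mul_sum]
          exact Finset.sum_congr rfl fun x _ => by ring
  exact le_of_tendsto_of_tendsto hlim (hRiem.const_mul _) hev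

/-- **The two-point local decay of a soft-bundle limit** (the hypothesis of `CurvatureKernel.KernelConclusionOfWitnessLocalDecay`,
verbatim, for the bundle's `S₁`): with the E0′ import `MomentBounds6` in hand, for `0 < s < 1` and real tensors `F = f 0 ⊗ f 1`
supported in the closed `r`-balls about `∓ s e₀`, `r ≤ s/2`, `‖S₁ 2 F‖ ≤ A ‖f 0‖₁ ‖f 1‖₁` with
`A = (C (24/s + 2/ℓ₄ + 24)⁴)² ≤ (C (48 + 2/ℓ₄)⁴)² · s^(2−10)` (`η = 2`, `B = 0`). -/
theorem twoPointLocalDecay_of_bundle {G : Type} [Group G] [TopologicalSpace G] [IsTopologicalGroup G] [CompactSpace G]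
    [MeasurableSpace G] [BorelSpace G] (r : LatticeRep G) (a : ℝ → ℝ) (sch : SpeciesScheme (YMSpecies G))
    (S₁ : SchwingerFamily (EuclideanSpace ℝ (Fin 4)))
    (Tq : (n : ℕ) → (Fin n → Fin 4 × Fin 4) → (𝓢((Fin n → EuclideanSpace ℝ (Fin 4)), ℂ) →L[ℂ] ℂ)) (K : ℝ) (b₀ : ℝ)
    (g : ℝ → ℕ → ℕ) (hMB6 : MomentBounds6 G r a) (hSB : SoftBundle G r a sch S₁ Tq K b₀ g) :
    ∃ (C η s₁ : ℝ), 0 < η ∧ 0 < s₁ ∧ (∀ (s : ℝ), 0 < s → s < s₁ → ∃ (r₀ A B : ℝ), 0 < r₀ ∧ 0 ≤ A ∧ 0 ≤ B ∧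
      A + B ≤ C * s ^ (η - 10) ∧ (∀ (r : ℝ), 0 < r → r ≤ r₀ →
        ∀ (f : Fin 2 → 𝓢(EuclideanSpace ℝ (Fin 4), ℝ)) (F : 𝓢((Fin 2 → EuclideanSpace ℝ (Fin 4)), ℂ)) (M₀ M₁ : ℝ),
          IsTensorOf F (fun i => ofRealTest (f i)) →
          tsupport ((f 0 : 𝓢(EuclideanSpace ℝ (Fin 4), ℝ)) : EuclideanSpace ℝ (Fin 4) → ℝ) ⊆
            Metric.closedBall (EuclideanSpace.single (0 : Fin 4) (-s)) r →
          tsupport ((f 1 : 𝓢(EuclideanSpace ℝ (Fin 4), ℝ)) : EuclideanSpace ℝ (Fin 4) → ℝ) ⊆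
            Metric.closedBall (EuclideanSpace.single (0 : Fin 4) s) r →
          (∀ x, |f 0 x| ≤ M₀) → (∀ x, |f 1 x| ≤ M₁) →
            ‖S₁ 2 F‖ ≤ A * (∫ x : EuclideanSpace ℝ (Fin 4), |f 0 x|) * (∫ x : EuclideanSpace ℝ (Fin 4), |f 1 x|) +
              B * r ^ 8 * M₀ * M₁)) := by
  obtain ⟨C, ℓ₄, hC, hℓ, hD⟩ := offDiagDensity_quant r a sch S₁ Tq K b₀ g hMB6 hSB
  set κ₁ : ℝ := 24 + 2 / ℓ₄ + 24 with hκ₁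
  have hκ₁0 : 0 < κ₁ := by positivity
  refine ⟨(C * κ₁ ^ 4) ^ 2, 2, 1, two_pos, one_pos, fun s hs hs1 => ?_⟩
  have hκs0 : 0 < 24 / s + 2 / ℓ₄ + 24 := by positivity
  refine ⟨s / 2, (C * (24 / s + 2 / ℓ₄ + 24) ^ 4) ^ 2, 0, half_pos hs, by positivity, le_rfl, ?_, ?_⟩
  · -- `A + 0 ≤ (C κ₁⁴)² · s^(2−10)`
    rw [add_zero]
    have hsinv : 1 ≤ s⁻¹ := one_le_inv_iff₀.2 ⟨hs, hs1.le⟩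
    have hκ : 24 / s + 2 / ℓ₄ + 24 ≤ κ₁ * s⁻¹ := by
      have h2 : 0 ≤ 2 / ℓ₄ + 24 := by positivity
      have : 2 / ℓ₄ + 24 ≤ (2 / ℓ₄ + 24) * s⁻¹ := by nlinarith
      rw [hκ₁, div_eq_mul_inv]
      nlinarith
    have hrpow : s ^ ((2 : ℝ) - 10) = s⁻¹ ^ (8 : ℕ) := by
      rw [show (2 : ℝ) - 10 = -((8 : ℕ) : ℝ) by norm_num, Real.rpow_neg hs.le, Real.rpow_natCast, inv_pow]
    calc (C * (24 / s + 2 / ℓ₄ + 24) ^ 4) ^ 2 ≤ (C * (κ₁ * s⁻¹) ^ 4) ^ 2 :=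
          pow_le_pow_left₀ (by positivity)
            (mul_le_mul_of_nonneg_left (pow_le_pow_left₀ hκs0.le hκ 4) hC) 2
      _ = (C * κ₁ ^ 4) ^ 2 * s⁻¹ ^ (8 : ℕ) := by ring
      _ = (C * κ₁ ^ 4) ^ 2 * s ^ ((2 : ℝ) - 10) := by rw [hrpow]
  · intro ρ hρ hρs f F M₀ M₁ hFt hsupp₀ hsupp₁ _ _
    -- the tensor, pointwise
    have F_apply : ∀ x : Fin 2 → EuclideanSpace ℝ (Fin 4), F x = ((f 0 (x 0) * f 1 (x 1) : ℝ) : ℂ) := by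
      intro x
      rw [hFt x, Fin.prod_univ_two, ofRealTest_apply, ofRealTest_apply, Complex.ofReal_mul]
    have norm_F : ∀ x : Fin 2 → EuclideanSpace ℝ (Fin 4), ‖F x‖ = |f 0 (x 0)| * |f 1 (x 1)| := by
      intro x
      rw [F_apply, Complex.norm_real, Real.norm_eq_abs, abs_mul]
    -- the support of `F` sits in the product of the two balls
    have hπ0 : Continuous fun x : Fin 2 → EuclideanSpace ℝ (Fin 4) => x 0 := continuous_apply 0
    have hπ1 : Continuous fun x : Fin 2 → EuclideanSpace ℝ (Fin 4) => x 1 := continuous_apply 1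
    set T : Set (Fin 2 → EuclideanSpace ℝ (Fin 4)) :=
      (fun x : Fin 2 → EuclideanSpace ℝ (Fin 4) => x 0) ⁻¹'
          closedBall (EuclideanSpace.single (0 : Fin 4) (-s) : EuclideanSpace ℝ (Fin 4)) ρ ∩
        (fun x : Fin 2 → EuclideanSpace ℝ (Fin 4) => x 1) ⁻¹'
          closedBall (EuclideanSpace.single (0 : Fin 4) s : EuclideanSpace ℝ (Fin 4)) ρ with hT
    have hTclosed : IsClosed T := (isClosed_closedBall.preimage hπ0).inter (isClosed_closedBall.preimage hπ1)
    have hsuppT : tsupport (F : (Fin 2 → EuclideanSpace ℝ (Fin 4)) → ℂ) ⊆ T := by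
      refine closure_minimal (fun x hx => ?_) hTclosed
      have h01 : f 0 (x 0) * f 1 (x 1) ≠ 0 := by
        intro h
        apply hx
        show F x = 0
        rw [F_apply, h]
        simp
      obtain ⟨h0, h1⟩ := mul_ne_zero_iff.1 h01
      exact ⟨hsupp₀ (subset_tsupport _ h0), hsupp₁ (subset_tsupport _ h1)⟩
    -- hence `F` is compactly supported …
    have hTball : T ⊆ closedBall (0 : Fin 2 → EuclideanSpace ℝ (Fin 4)) (s + ρ) := by
      rintro x ⟨hx0, hx1⟩
      rw [mem_closedBall, dist_zero_right]
      refine (pi_norm_le_iff_of_nonneg (by positivity)).2 fun i => ?_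
      simp only [Set.mem_preimage, mem_closedBall, dist_eq_norm] at hx0 hx1
      have hn0 : ‖(EuclideanSpace.single (0 : Fin 4) (-s) : EuclideanSpace ℝ (Fin 4))‖ = s := by
        simp [abs_of_pos hs]
      have hn1 : ‖(EuclideanSpace.single (0 : Fin 4) s : EuclideanSpace ℝ (Fin 4))‖ = s := by
        simp [abs_of_pos hs]
      fin_cases i
      · calc ‖x 0‖ = ‖(x 0 - EuclideanSpace.single (0 : Fin 4) (-s)) + EuclideanSpace.single (0 : Fin 4) (-s)‖ := by
              rw [sub_add_cancel]
          _ ≤ ‖x 0 - EuclideanSpace.single (0 : Fin 4) (-s)‖ + ‖(EuclideanSpace.single (0 : Fin 4) (-s) : EuclideanSpace ℝ (Fin 4))‖ :=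
              norm_add_le _ _
          _ ≤ s + ρ := by rw [hn0]; linarith
      · calc ‖x 1‖ = ‖(x 1 - EuclideanSpace.single (0 : Fin 4) s) + EuclideanSpace.single (0 : Fin 4) s‖ := by
              rw [sub_add_cancel]
          _ ≤ ‖x 1 - EuclideanSpace.single (0 : Fin 4) s‖ + ‖(EuclideanSpace.single (0 : Fin 4) s : EuclideanSpace ℝ (Fin 4))‖ :=
              norm_add_le _ _
          _ ≤ s + ρ := by rw [hn1]; linarith
    have hFc : HasCompactSupport (F : (Fin 2 → EuclideanSpace ℝ (Fin 4)) → ℂ) :=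
      IsCompact.of_isClosed_subset (isCompact_closedBall _ _) (isClosed_tsupport _) (hsuppT.trans hTball)
    -- … and supported at separation `≥ s`
    have hFs : tsupport (F : (Fin 2 → EuclideanSpace ℝ (Fin 4)) → ℂ) ⊆ Separated 2 s := by
      intro x hx i j hij
      obtain ⟨hx0, hx1⟩ := hsuppT hx
      have hw := (norm_sub_mem_window_of_balls hs hρs hx0 hx1).1
      fin_cases i <;> fin_cases j
      · exact absurd rfl hij
      · rwa [dist_eq_norm]
      · rwa [dist_comm, dist_eq_norm]
      · exact absurd rfl hij
    -- the quantitative density bound at `δ = s`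
    have h := hD 2 le_rfl s hs F hFc hFs
    rw [zero_mul, zero_mul, zero_mul, add_zero]
    calc ‖S₁ 2 F‖ ≤ (C * (24 / s + 2 / ℓ₄ + 24) ^ 4) ^ 2 * ∫ y, ‖F y‖ := h
      _ = (C * (24 / s + 2 / ℓ₄ + 24) ^ 4) ^ 2 *
            ((∫ y : EuclideanSpace ℝ (Fin 4), |f 0 y|) * ∫ y : EuclideanSpace ℝ (Fin 4), |f 1 y|) := by
          rw [← integral_abs_tensor f]
          congr 1
          exact integral_congr_ae (Eventually.of_forall norm_F)
      _ = _ := by ring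

end Summit.QuantumFields.YangMills.Cruxes.OSLegsAtWeakCouplingC.Sketch

end
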